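import Mathlib
import Literature.Geometry.Lorentzian.ReggeWheelerChannels
import Literature.Geometry.Lorentzian.ReggeWheelerTortoise
import Summits.FinalStateConjecture.FinalStateConjecture.Theorems.PhotonSphereChannelsUniformPhotonSphereChannelsRNearLogEdgeChannelsExplicit

/-!
# Route PhotonSphereChannels, line `crum-peeling-recessive-tower` — stub N: the near log-edge
# channel inequality with uniform constants

Stub `stub_nearLogEdgeChannels` of the skeleton of crux `UniformPhotonSphereChannelsR` (K1R,
stmt-FinalStateConjecture-14074): the NEAR (horizon-side) one-ended channel-of-energy inequality for
the spin-`s` Regge–Wheeler family with constants `ρ₀(M), C(M), c(M)` uniform in `(s, ℓ, ρ)` on the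
log-ball `ρ ≥ ρ₀ + C log(ℓ+1)`:
`c · inf_{p ∈ P_near(ρ)} E_{x < xc−ρ}[ψ − p](0) ≤ liminf_{+∞} E_near + liminf_{−∞} E_near`.

Proof: the landed per-mode theorem with its witnesses exposed
(`CrumPeelingRecessiveTower.nearHalfLineChannels_explicit`: `c = 1/4`,
`ρ₀(M, ℓ) = max 0 (2M log(25600 M² B e^{3/2M}))`, `B = (ℓ(ℓ+1)+1) B₁`,
`B₁ = (2M)⁻³ e^{(r*(3M) − 2M)/2M}`), and the bookkeeping
`ρ₀(M, ℓ) ≤ ρ₀'(M) + 4M log(ℓ+1)` with `ρ₀'(M) = max 0 (2M log(25600 M² B₁ e^{3/2M}))`, from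
`log(ℓ² + ℓ + 1) ≤ 2 log(ℓ + 1)`; so `ρ₀ = ρ₀'(M)`, `C = 4M`, `c = 1/4`.  The statement is phrased in
the vocabulary of `Literature.Geometry.Lorentzian.ReggeWheelerChannels` (`linePotential`,
`energyDensity`, `IsSolutionOn`, `IsPolynomialInTimeOn`, `IsRWSolution`, `IsTortoiseRadius`), which
unfolds definitionally to the inlined `let`s of the per-mode theorem; the two near kernels agree up
to reassociating a conjunction.
-/

noncomputable section

namespace Summit.FinalStateConjecture.FinalStateConjecture.Theorems.CrumPeelingRecessiveTower

open Literature.Geometry.Lorentzian Literature.Geometry.Lorentzian.ReggeWheeler MeasureTheory Filter Set Topology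
open Literature.Barriers.FinalStateConjecture
open scoped ENNReal

/-- `log(ℓ² + ℓ + 1) ≤ 2 log(ℓ + 1)` for `ℓ : ℕ` (as `ℓ² + ℓ + 1 ≤ (ℓ + 1)²`). -/
theorem log_sq_add_self_add_one_le (ℓ : ℕ) :
    Real.log ((ℓ : ℝ) * ((ℓ : ℝ) + 1) + 1) ≤ 2 * Real.log ((ℓ : ℝ) + 1) := by
  have hℓ : (0 : ℝ) ≤ ℓ := Nat.cast_nonneg ℓ
  have h2 : Real.log (((ℓ : ℝ) + 1) ^ 2) = 2 * Real.log ((ℓ : ℝ) + 1) := by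
    rw [Real.log_pow]; norm_num
  rw [← h2]
  exact Real.log_le_log (by positivity) (by nlinarith)

/-- **Threshold bookkeeping.** With `A = 25600 M² (2M)⁻³ E e^{3/2M}` the per-mode threshold
`max 0 (2M log(A (ℓ²+ℓ+1)))` is at most `max 0 (2M log A) + 4M log(ℓ+1)`; hence every
`ρ ≥ max 0 (2M log A) + 4M log(ℓ+1)` is beyond the per-mode threshold. -/
theorem perMode_threshold_le {M E ρ : ℝ} (hM : 0 < M) (hE : 0 < E) (ℓ : ℕ)
    (hρ : max 0 (2 * M * Real.log (25600 * M ^ 2 * (1 / (2 * M) ^ 3 * E) * Real.exp (3 / (2 * M))))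
      + 4 * M * Real.log ((ℓ : ℝ) + 1) ≤ ρ) :
    max 0 (2 * M * Real.log (25600 * M ^ 2 * (((ℓ : ℝ) * ((ℓ : ℝ) + 1) + 1) / (2 * M) ^ 3 * E)
      * Real.exp (3 / (2 * M)))) ≤ ρ := by
  have hℓ : (0 : ℝ) ≤ ℓ := Nat.cast_nonneg ℓ
  have hL0 : 0 < (ℓ : ℝ) * ((ℓ : ℝ) + 1) + 1 := by positivity
  have hlog0 : 0 ≤ Real.log ((ℓ : ℝ) + 1) := Real.log_nonneg (by linarith)
  have hA0 : 0 < 25600 * M ^ 2 * (1 / (2 * M) ^ 3 * E) * Real.exp (3 / (2 * M)) := by positivity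
  have hρ0 : 0 ≤ ρ := le_trans (add_nonneg (le_max_left _ _) (by positivity)) hρ
  refine max_le hρ0 (le_trans ?_ hρ)
  have hsplit : 25600 * M ^ 2 * (((ℓ : ℝ) * ((ℓ : ℝ) + 1) + 1) / (2 * M) ^ 3 * E)
      * Real.exp (3 / (2 * M))
      = 25600 * M ^ 2 * (1 / (2 * M) ^ 3 * E) * Real.exp (3 / (2 * M))
        * ((ℓ : ℝ) * ((ℓ : ℝ) + 1) + 1) := by
    ring
  rw [hsplit, Real.log_mul hA0.ne' hL0.ne', mul_add]
  have h1 : 2 * M * Real.log (25600 * M ^ 2 * (1 / (2 * M) ^ 3 * E) * Real.exp (3 / (2 * M)))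
      ≤ max 0 (2 * M * Real.log (25600 * M ^ 2 * (1 / (2 * M) ^ 3 * E) * Real.exp (3 / (2 * M)))) :=
    le_max_right _ _
  have h2 := log_sq_add_self_add_one_le ℓ
  nlinarith [h1, h2, hM]

/-- **Stub N — near log-edge channels, uniform.**  The NEAR (horizon-side) half-line channel
inequality with constants uniform in `(s, ℓ, ρ)` on the log-ball: `∃ ρ₀(M), C(M), c(M)` such that
for every tortoise radius function, `s ≤ 2`, `ℓ ≥ s`, `ρ ≥ ρ₀ + C log(ℓ+1)` and every global
Regge–Wheeler solution `ψ`,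
`c · inf_{p ∈ P_near(ρ)} E_{x < xc−ρ}[ψ − p](0) ≤ liminf_{+∞} E_near + liminf_{−∞} E_near`,
`E_near(t)` the energy on `{x < xc − ρ − |t|}`, `P_near` the `t`-polynomial `C²` solutions on the
near cone.  Witnesses: `ρ₀ = max 0 (2M log(25600 M² (2M)⁻³ e^{(r*(3M)−2M)/2M} e^{3/2M}))`,
`C = 4M`, `c = 1/4` (the landed per-mode theorem `Theorems.nearHalfLineChannels`, p73389, with its
witnesses exposed: `nearHalfLineChannels_explicit`). -/
theorem stub_nearLogEdgeChannels :
    ∀ M : ℝ, 0 < M → ∃ ρ₀ : ℝ, 0 ≤ ρ₀ ∧ ∃ C : ℝ, 0 ≤ C ∧ ∃ c : ℝ, 0 < c ∧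
      ∀ (r : ℝ → ℝ) (xc : ℝ), IsTortoiseRadius M r xc → ∀ (s ℓ : ℕ), s ≤ 2 → s ≤ ℓ →
        ∀ ρ : ℝ, ρ₀ + C * Real.log ((ℓ : ℝ) + 1) ≤ ρ →
          ∀ ψ : ℝ → ℝ → ℝ, IsRWSolution M s ℓ r ψ →
            ENNReal.ofReal c *
                (⨅ p ∈ {p : ℝ → ℝ → ℝ |
                    IsSolutionOn (linePotential M s ℓ r) p {z : ℝ × ℝ | z.2 < xc - ρ - |z.1|} ∧
                      IsPolynomialInTimeOn p {z : ℝ × ℝ | z.2 < xc - ρ - |z.1|}},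
                  ∫⁻ x in Set.Iio (xc - ρ), ENNReal.ofReal
                    (energyDensity (linePotential M s ℓ r) (fun t y => ψ t y - p t y) 0 x))
              ≤ liminf (fun t => ∫⁻ x in Set.Iio (xc - ρ - |t|),
                    ENNReal.ofReal (energyDensity (linePotential M s ℓ r) ψ t x)) atTop
                + liminf (fun t => ∫⁻ x in Set.Iio (xc - ρ - |t|),
                    ENNReal.ofReal (energyDensity (linePotential M s ℓ r) ψ t x)) atBot := by
  intro M hM
  refine ⟨max 0 (2 * M * Real.log (25600 * M ^ 2 * (1 / (2 * M) ^ 3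
      * Real.exp ((efTortoiseCoord M (3 * M) - 2 * M) / (2 * M))) * Real.exp (3 / (2 * M)))),
    le_max_left _ _, 4 * M, by positivity, 1 / 4, by norm_num, ?_⟩
  intro r xc hr s ℓ hs hsℓ ρ hρ ψ hψ
  -- `ρ` is beyond the per-mode threshold `ρ₀(M, ℓ)`
  have hρ' := perMode_threshold_le hM (Real.exp_pos _) ℓ hρ
  -- the per-mode theorem with explicit constants, in the inlined phrasing of the route item
  have key := nearHalfLineChannels_explicit M hM s ℓ hs hsℓ r xc hr.two_mul_lt hr.hasDerivAt
    hr.center ρ hρ' ψ hψ.1 fun z => hψ.2 z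
  -- the two near kernels agree (`IsSolutionOn = ContDiffOn ∧ ∀ z ∈ Ω, IsSolutionAt`, reassociated)
  have hP : {p : ℝ → ℝ → ℝ |
        IsSolutionOn (linePotential M s ℓ r) p {z : ℝ × ℝ | z.2 < xc - ρ - |z.1|} ∧
          IsPolynomialInTimeOn p {z : ℝ × ℝ | z.2 < xc - ρ - |z.1|}} =
      {p : ℝ → ℝ → ℝ |
        ContDiffOn ℝ 2 (Function.uncurry p) {z : ℝ × ℝ | z.2 < xc - ρ - |z.1|} ∧
          (∀ z ∈ {z : ℝ × ℝ | z.2 < xc - ρ - |z.1|}, IsSolutionAt (linePotential M s ℓ r) p z) ∧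
            IsPolynomialInTimeOn p {z : ℝ × ℝ | z.2 < xc - ρ - |z.1|}} := by
    ext p
    simp only [IsSolutionOn, mem_setOf_eq, and_assoc]
  rw [hP]
  exact key

end Summit.FinalStateConjecture.FinalStateConjecture.Theorems.CrumPeelingRecessiveTower
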